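import Summits.Ventures.LatticeQCDFlow.Scaling.AdjacentPerAttemptMeanCondition
import Summits.Ventures.LatticeQCDFlow.Scaling.ClockConditionedEdgeRates
import Summits.Ventures.LatticeQCDFlow.Scaling.LumpedStarStepMixingTime

/-!
HONEST FRAMING: exact (Metropolis-corrected) sampling algorithms for lattice gauge theory; figures
of merit are autocorrelation/cost numbers at stated couplings and volumes; no continuum-physics
claim.

# LumpedStarClockDecay — OPEN-MATH ITEM 1 (i) (b′), THE SHARP STEP LAW: THE STEP CHAIN OF THE LUMPED STAR (ONE SWAP ATTEMPT W.P. `σ`, A REDRAW W.P. `1−σ`) HAS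
# `d(n) ≤ (2D/r)·(1 + (1−σ)r/48)⁻ⁿ`, `r = σpE_{μ0}[Wθ]/(c+2K+2)`, `D = (K+1)(c+2K+2) + 2(K+1)(c+2K+6)`, ANY `c ≥ 2K+4`, `K ≥ 2` — UNCONDITIONAL (lean-2 GEN-44, ours)

Venture-side (OURS).  Cell `lqcd-flow` (pub-lqcd), unit `pub-lqcd-lean-2-g44`, 2026-08-31.  Chapter AD, file 3 = THE INSTANTIATION of the C2 ∕ C4 assembly (memo MEMO-gen43 §3 (g)) on
the step objects of chapter X file 5 (`A` = one swap attempt, `B` = the redraw, `S = σA + (1−σ)B`, stationary law `π_S`).  The `j`-attempt cycle kernels `C_j = AʲB` are chapter W's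
cycle kernel with the `j`-attempt hub law (AC14); chapter W file 2 couples `C_j(x,·), C_j(y,·)` for EVERY pair through the optimal coupling of the two `j`-attempt hub laws
(`lumpedAny_isMarkovianCoupling`) and computes the one-step image of the product potential `Ψ = Δ·F + C·𝟙{hubs differ}` (`lumpedAny_mulVec_potential`); the edges are W19's (adjacent
equal-hub pairs of length `F`, unequal-hub pairs of length `C`), the pseudo-metric is W17's with `d ≤ Ψ` by W18; the per-edge per-attempt rates are `r_j(x,y) = 1 − (Q_jΨ)(x,y)/ℓ(x,y)`
(`∈ [−2, 1]` by file 1 and W7's crude bound); the discounted mean condition on an adjacent equal-hub edge is file 2 in the orientation `W_b ≤ W_a` and follows for the other orientation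
by transposition (file 1, W23's device), on an unequal-hub edge it is `Σ_{j<n}σʲ(1−σ)·½ ≤ ½ ≤ 1 − r̃`; then chapter AC file 6 `clock_worstTvDist_le_edgeRates` (`q = 2`, `r̃ = 2r`).  HYPOTHESES: the
lumped star of chapter W file 27 with the tagged chains and tail resolvents of every oriented adjacent pair given by their hypothesis-equations (exactly the list of X6
`lumpedStar_step_mixingTime_le`, WITHOUT its end-hub laws, couplings, cycle chain and rate), `K ≥ 2`, `c ≥ 2K+4`, `0 < σ < 1`, `μ_0 > 0`, `pE_{μ0}[Wθ] > 0`.  NO domination or certificate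
hypothesis: those are theorems (W26, Z4, AC3, AC13).

* `lumpedStar_step_stationary` (`π_S S = π_S`), **`lumpedStar_clock_worstTvDist_le`**.  File 4 reads off the mixing time `⌈(log(1/ε₀) + log(2D/r))/log(1 + (1−σ)r/48)⌉`.

Reading (no numerics implied): relaxation in `O(K/((1−σ)σp̄))` steps with a prefactor polynomial in `K` — the `½log(1/π_min) = O(K log(1/min μ_0W))` of the spectral route (X6)
replaced by `log K`; this closes route (β) of OPEN-MATH (b′) for the lumped star.  Literature grade (cell rule): OWN, on the tree's LPW files through chapters W–AC; nothing cited; no new bib keys.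
-/

open Finset Matrix
open Literature.Probability.MarkovChains

namespace Summit.Ventures.LatticeQCDFlow.Scaling

section ClockLaw
variable {X : Type*} [Fintype X] [DecidableEq X] {S : Type*} [Fintype S] [DecidableEq S]
variable {hub : X → S} {comp : X → S → ℕ} {K : ℕ} {μ0 W θ : S → ℝ} {p σ c C : ℝ} {acc : S → S → ℝ} {Kh : (S → ℕ) → S → S → ℝ}
variable {Δ : (S → ℕ) → (S → ℕ) → ℕ} {F Ψ : X × X → ℝ}
variable {NCf : X → X → S → ℕ} {af bf : X → X → S} {PXf PYf : X → X → Option S → Option S → ℝ} {xtf ytf xsf ysf : X → X → Option S → ℝ}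
variable {Ast Bst Sst : X → X → ℝ} {g : (S → ℕ) → ℝ} {πS : X → ℝ} {Z : ℝ}

omit [DecidableEq X] in
/-- **`π_S` is stationary for the step chain `S = σA + (1−σ)B`** (both parts are `π_S`-reversible with unit row sums, X5). [ours] -/
theorem lumpedStar_step_stationary (hinj : ∀ x x', hub x = hub x' → comp x = comp x' → x = x')
    (hsurj : ∀ (z : S) (N : S → ℕ), ∑ v, N v = K + 1 → N z ≠ 0 → ∃ x, hub x = z ∧ comp x = N) (hhub : ∀ x, comp x (hub x) ≠ 0)
    (hsum : ∀ x, ∑ v, comp x v = K + 1) (hW : ∀ v, 0 < W v) (hacc : ∀ h v, acc h v = min 1 (W h / W v)) (hμ1 : ∑ v, μ0 v = 1)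
    (hKoff : ∀ N h v, h ≠ v → Kh N h v = if N h = 0 then 0 else (N v : ℝ) / K * acc h v) (hKdiag : ∀ N h, Kh N h h = 1 - ∑ v ∈ univ.erase h, Kh N h v)
    (hA : ∀ x x', Ast x x' = if comp x' = comp x then Kh (comp x) (hub x) (hub x') else 0)
    (hB : ∀ x x', Bst x x' = μ0 (hub x') * (if comp x' + Pi.single (hub x) 1 = comp x + Pi.single (hub x') 1 then 1 else 0))
    (hS : ∀ x x', Sst x x' = σ * Ast x x' + (1 - σ) * Bst x x')
    (hg : ∀ N, g N = ∏ v, (μ0 v * W v) ^ (N v) / ((N v).factorial : ℝ))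
    (hπS : ∀ x, πS x = g (comp x) * ((comp x (hub x) : ℝ) / W (hub x)) / Z) : IsStationary πS Sst := by
  classical
  have hA1 : ∀ x, ∑ x', Ast x x' = 1 := starStep_swap_rowsum hinj hsurj hhub hsum hKoff hKdiag hA
  have hArev : ∀ x x', πS x * Ast x x' = πS x' * Ast x' x := starStep_swap_reversible hinj hhub hW hacc hKoff hA hπS
  have hB1 : ∀ x, ∑ x', Bst x x' = 1 := starStep_redraw_rowsum hinj hsurj hhub hsum hμ1 hB
  have hBrev : ∀ x x', πS x * Bst x x' = πS x' * Bst x' x := starStep_redraw_reversible hhub hW hg hπS hB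
  intro y
  calc ∑ x, πS x * Sst x y = ∑ x, (σ * (πS y * Ast y x) + (1 - σ) * (πS y * Bst y x)) :=
        sum_congr rfl fun x _ => by rw [hS, ← hArev, ← hBrev]; ring
    _ = σ * (πS y * ∑ x, Ast y x) + (1 - σ) * (πS y * ∑ x, Bst y x) := by rw [sum_add_distrib, ← mul_sum, ← mul_sum, ← mul_sum, ← mul_sum]
    _ = πS y := by rw [hA1, hB1]; ring

/-- **THE LAW OF THE LUMPED STAR'S STEP CHAIN, SHARP FORM** (see the module docstring). [ours] -/
theorem lumpedStar_clock_worstTvDist_le [Nonempty X] (hinj : ∀ x x', hub x = hub x' → comp x = comp x' → x = x') (hsum : ∀ x, ∑ v, comp x v = K + 1)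
    (hsurj : ∀ (z : S) (N : S → ℕ), ∑ v, N v = K + 1 → N z ≠ 0 → ∃ x, hub x = z ∧ comp x = N) (hhub : ∀ x, comp x (hub x) ≠ 0) (hK : 2 ≤ K)
    (hW : ∀ v, 0 < W v) (hp0 : 0 ≤ p) (hp : ∀ v, p * W v ≤ 1) (hθ : ∀ v, θ v = 1 / (1 + p * W v)) (hacc : ∀ h v, acc h v = min 1 (W h / W v))
    (hμ0 : ∀ v, 0 ≤ μ0 v) (hμ1 : ∑ v, μ0 v = 1) (hμpos : ∀ v, 0 < μ0 v) (hc : 2 * (K : ℝ) + 4 ≤ c) (hσ0 : 0 < σ) (hσ1 : σ < 1)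
    (hgap : 0 < p * ∑ v, μ0 v * (W v * θ v))
    (hKoff : ∀ N h v, h ≠ v → Kh N h v = if N h = 0 then 0 else (N v : ℝ) / K * acc h v) (hKdiag : ∀ N h, Kh N h h = 1 - ∑ v ∈ univ.erase h, Kh N h v)
    (hΔ : ∀ N N', Δ N N' = ∑ v, (N v - N' v))
    (hF : ∀ x y, F (x, y) = c + (-(1 - σ) * θ (hub x)) + (-(1 - σ) * θ (hub y)) + ∑ v, θ v * ((comp x v : ℝ) + (comp y v : ℝ)))
    (hC : C = 2 * ((K + 1) * (c + 2 * K + 6)))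
    (hΨ : ∀ x y, Ψ (x, y) = (Δ (comp x) (comp y) : ℝ) * F (x, y) + C * (if hub x = hub y then (0 : ℝ) else 1))
    -- the tagged data of every ORIENTED adjacent pair (as in W23 ∕ X6)
    (horient : ∀ x y, hub x = hub y → Δ (comp x) (comp y) = 1 → W (bf x y) ≤ W (af x y) ∨ W (bf y x) ≤ W (af y x))
    (hcx : ∀ x y, hub x = hub y → Δ (comp x) (comp y) = 1 → W (bf x y) ≤ W (af x y) → comp x = NCf x y + Pi.single (af x y) 1)
    (hcy : ∀ x y, hub x = hub y → Δ (comp x) (comp y) = 1 → W (bf x y) ≤ W (af x y) → comp y = NCf x y + Pi.single (bf x y) 1)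
    (hPXoff : ∀ x y, hub x = hub y → Δ (comp x) (comp y) = 1 → W (bf x y) ≤ W (af x y) →
      ∀ h v, h ≠ v → PXf x y (some h) (some v) = if NCf x y h = 0 then 0 else (NCf x y v : ℝ) / K * acc h v)
    (hPXin : ∀ x y, hub x = hub y → Δ (comp x) (comp y) = 1 → W (bf x y) ≤ W (af x y) →
      ∀ h, PXf x y (some h) none = if NCf x y h = 0 then 0 else acc h (af x y) / K)
    (hPXdiag : ∀ x y, hub x = hub y → Δ (comp x) (comp y) = 1 → W (bf x y) ≤ W (af x y) →
      ∀ h, PXf x y (some h) (some h) = 1 - (∑ v ∈ univ.erase h, PXf x y (some h) (some v) + PXf x y (some h) none))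
    (hPXout : ∀ x y, hub x = hub y → Δ (comp x) (comp y) = 1 → W (bf x y) ≤ W (af x y) → ∀ v, PXf x y none (some v) = (NCf x y v : ℝ) / K * acc (af x y) v)
    (hPXstay : ∀ x y, hub x = hub y → Δ (comp x) (comp y) = 1 → W (bf x y) ≤ W (af x y) → PXf x y none none = 1 - ∑ v, PXf x y none (some v))
    (hPYoff : ∀ x y, hub x = hub y → Δ (comp x) (comp y) = 1 → W (bf x y) ≤ W (af x y) →
      ∀ h v, h ≠ v → PYf x y (some h) (some v) = if NCf x y h = 0 then 0 else (NCf x y v : ℝ) / K * acc h v)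
    (hPYin : ∀ x y, hub x = hub y → Δ (comp x) (comp y) = 1 → W (bf x y) ≤ W (af x y) →
      ∀ h, PYf x y (some h) none = if NCf x y h = 0 then 0 else acc h (bf x y) / K)
    (hPYdiag : ∀ x y, hub x = hub y → Δ (comp x) (comp y) = 1 → W (bf x y) ≤ W (af x y) →
      ∀ h, PYf x y (some h) (some h) = 1 - (∑ v ∈ univ.erase h, PYf x y (some h) (some v) + PYf x y (some h) none))
    (hPYout : ∀ x y, hub x = hub y → Δ (comp x) (comp y) = 1 → W (bf x y) ≤ W (af x y) → ∀ v, PYf x y none (some v) = (NCf x y v : ℝ) / K * acc (bf x y) v)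
    (hPYstay : ∀ x y, hub x = hub y → Δ (comp x) (comp y) = 1 → W (bf x y) ≤ W (af x y) → PYf x y none none = 1 - ∑ v, PYf x y none (some v))
    (hxtf : ∀ x y, hub x = hub y → Δ (comp x) (comp y) = 1 → W (bf x y) ≤ W (af x y) →
      ∀ t, xtf x y t = (1 - σ) * PXf x y (some (hub x)) t + σ * ∑ t', xtf x y t' * PXf x y t' t)
    (hytf : ∀ x y, hub x = hub y → Δ (comp x) (comp y) = 1 → W (bf x y) ≤ W (af x y) →
      ∀ t, ytf x y t = (1 - σ) * PYf x y (some (hub x)) t + σ * ∑ t', ytf x y t' * PYf x y t' t)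
    (hxsf : ∀ x y, hub x = hub y → Δ (comp x) (comp y) = 1 → W (bf x y) ≤ W (af x y) →
      ∀ t, xsf x y t = (1 - σ) * PXf x y none t + σ * ∑ t', xsf x y t' * PXf x y t' t)
    (hysf : ∀ x y, hub x = hub y → Δ (comp x) (comp y) = 1 → W (bf x y) ≤ W (af x y) →
      ∀ t, ysf x y t = (1 - σ) * PYf x y none t + σ * ∑ t', ysf x y t' * PYf x y t' t)
    -- the step chain of the lumped star (file X5 `LumpedStarStepChain`)
    (hA : ∀ x x', Ast x x' = if comp x' = comp x then Kh (comp x) (hub x) (hub x') else 0)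
    (hB : ∀ x x', Bst x x' = μ0 (hub x') * (if comp x' + Pi.single (hub x) 1 = comp x + Pi.single (hub x') 1 then 1 else 0))
    (hS : ∀ x x', Sst x x' = σ * Ast x x' + (1 - σ) * Bst x x')
    (hg : ∀ N, g N = ∏ v, (μ0 v * W v) ^ (N v) / ((N v).factorial : ℝ))
    (hZ : Z = ∑ x, g (comp x) * ((comp x (hub x) : ℝ) / W (hub x))) (hπS : ∀ x, πS x = g (comp x) * ((comp x (hub x) : ℝ) / W (hub x)) / Z)
    (n : ℕ) :
    worstTvDist Sst πS n ≤ 2 * (((K : ℝ) + 1) * (c + 2 * K + 2) + C) / (σ * (p * ∑ v, μ0 v * (W v * θ v)) / (c + 2 * K + 2))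
        * ((1 + (1 - σ) * (σ * (p * ∑ v, μ0 v * (W v * θ v)) / (c + 2 * K + 2)) / 48)⁻¹) ^ n := by
  classical
  -- §0 scalars
  have hK1 : 1 ≤ K := le_trans (by norm_num) hK
  have hK0 : (0 : ℝ) ≤ K := Nat.cast_nonneg _
  have hθm := theta_mem hW hp0 hp hθ
  have hpbar : p * ∑ v, μ0 v * (W v * θ v) ≤ 1 / 2 := by
    calc p * ∑ v, μ0 v * (W v * θ v) = ∑ v, μ0 v * (p * (W v * θ v)) := by rw [mul_sum]; exact sum_congr rfl fun v _ => by ring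
      _ ≤ ∑ v, μ0 v * (1 / 2) := sum_le_sum fun v _ => mul_le_mul_of_nonneg_left (finiteOdds_pWθ_le_half hp0 hp hW hθ v) (hμ0 v)
      _ = 1 / 2 := by rw [← sum_mul, hμ1, one_mul]
  have hcK : 0 < c + 2 * K + 2 := by linarith
  obtain ⟨rt, hrt⟩ : ∃ rt : ℝ, rt = 2 * (σ * (p * ∑ v, μ0 v * (W v * θ v)) / (c + 2 * K + 2)) := ⟨_, rfl⟩
  have hrt0 : 0 < rt := by rw [hrt]; exact mul_pos two_pos (div_pos (mul_pos hσ0 hgap) hcK)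
  have hrtc : rt * (c + 2 * K + 2) ≤ 2 * σ * (p * ∑ v, μ0 v * (W v * θ v)) := by rw [hrt]; apply le_of_eq; field_simp
  have hrthalf : rt ≤ 1 / 2 := by
    rw [hrt, mul_div_assoc', div_le_iff₀ hcK]
    have : σ * (p * ∑ v, μ0 v * (W v * θ v)) ≤ 1 * (1 / 2) := mul_le_mul hσ1.le hpbar hgap.le zero_le_one
    nlinarith only [this, hc, hK0]
  have hrt1 : rt ≤ 1 := by linarith only [hrthalf]
  -- §1 the step objects (X5), stationarity, powers and cycle kernels
  have hπ := lumpedStar_piS_pos hhub hW hμpos hg hZ hπS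
  have hπ1 := lumpedStar_piS_sum hhub hW hμpos hg hZ hπS
  have hA0 : ∀ x x', 0 ≤ Ast x x' := starStep_swap_nonneg hW hacc hK1 hsum hKoff hKdiag hA
  have hA1 : ∀ x, ∑ x', Ast x x' = 1 := starStep_swap_rowsum hinj hsurj hhub hsum hKoff hKdiag hA
  have hB0 : ∀ x x', 0 ≤ Bst x x' := fun x x' => by rw [hB]; exact mul_nonneg (hμ0 _) (by split_ifs <;> norm_num)
  have hB1 : ∀ x, ∑ x', Bst x x' = 1 := starStep_redraw_rowsum hinj hsurj hhub hsum hμ1 hB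
  have hstat : IsStationary πS Sst := lumpedStar_step_stationary hinj hsurj hhub hsum hW hacc hμ1 hKoff hKdiag hA hB hS hg hπS
  let Sn : ℕ → X → X → ℝ := fun n => Nat.rec (motive := fun _ => X → X → ℝ) (fun x y => if x = y then 1 else 0) (fun _ prev x y => ∑ z, Sst x z * prev z y) n
  let An : ℕ → X → X → ℝ := fun n => Nat.rec (motive := fun _ => X → X → ℝ) (fun x y => if x = y then 1 else 0) (fun _ prev x y => ∑ z, Ast x z * prev z y) n
  let Cc : ℕ → X → X → ℝ := fun n => Nat.rec (motive := fun _ => X → X → ℝ) (fun x y => Bst x y) (fun _ prev x y => ∑ z, Ast x z * prev z y) n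
  have hSn0 : ∀ x y, Sn 0 x y = if x = y then 1 else 0 := fun _ _ => rfl
  have hSns : ∀ n x y, Sn (n + 1) x y = ∑ z, Sst x z * Sn n z y := fun _ _ _ => rfl
  have hAn0 : ∀ x y, An 0 x y = if x = y then 1 else 0 := fun _ _ => rfl
  have hAns : ∀ n x y, An (n + 1) x y = ∑ z, Ast x z * An n z y := fun _ _ _ => rfl
  have hC0 : ∀ x y, Cc 0 x y = Bst x y := fun _ _ => rfl
  have hCs : ∀ j x y, Cc (j + 1) x y = ∑ z, Ast x z * Cc j z y := fun _ _ _ => rfl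
  -- the `j`-attempt hub laws (AC14, file 1)
  let w : ℕ → (S → ℕ) → S → S → ℝ := fun j => Nat.rec (motive := fun _ => (S → ℕ) → S → S → ℝ) (fun N h v => if v = h then 1 else 0)
    (fun _ prev N h v => ∑ g', Kh N h g' * prev N g' v) j
  have hw0 : ∀ N h v, w 0 N h v = if v = h then 1 else 0 := fun _ _ _ => rfl
  have hws : ∀ j N h v, w (j + 1) N h v = ∑ g', Kh N h g' * w j N g' v := fun _ _ _ _ => rfl
  have hCj : ∀ j x x', Cc j x x' = ∑ a, w j (comp x) (hub x) a * (μ0 (hub x') * (if comp x' + Pi.single a 1 = comp x + Pi.single (hub x') 1 then (1 : ℝ) else 0)) :=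
    starStep_cyclePow_eq hinj hsurj hhub hsum hKoff hA hB hC0 hCs hw0 hws
  have hWlaw : ∀ j x, (∀ a, 0 ≤ w j (comp x) (hub x) a) ∧ ∑ a, w j (comp x) (hub x) a = 1 := fun j x => by
    have h := hubLaw_nonneg_sum hW hacc hK1 hKoff hKdiag hw0 hws (hsum x) j
    exact ⟨h.1 (hub x), h.2 (hub x)⟩
  have hWlegal : ∀ j x a, w j (comp x) (hub x) a ≠ 0 → comp x a ≠ 0 := fun j x a => hubLaw_legal hKoff hw0 hws (hhub x) j a
  -- the end-hub couplings and the coupled cycle kernels (W file 2)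
  obtain ⟨q, hq⟩ : ∃ q : ℕ → X → X → S → S → ℝ, ∀ j x y a b, q j x y a b = optimalCoupling (w j (comp x) (hub x)) (w j (comp y) (hub y)) a b :=
    ⟨_, fun _ _ _ _ _ => rfl⟩
  have hqfun : ∀ j x y, q j x y = optimalCoupling (w j (comp x) (hub x)) (w j (comp y) (hub y)) := fun j x y => funext fun a => funext fun b => hq j x y a b
  have hqc : ∀ j x y, IsCoupling (w j (comp x) (hub x)) (w j (comp y) (hub y)) (q j x y) := fun j x y => by
    rw [hqfun]; exact optimalCoupling_isCoupling (hWlaw j x).1 (hWlaw j y).1 (hWlaw j x).2 (hWlaw j y).2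
  have hqleg : ∀ j x y a b, q j x y a b ≠ 0 → comp x a ≠ 0 ∧ comp y b ≠ 0 := fun j x y a b hne => by
    obtain ⟨ha, hb⟩ := urnChain_support (hqc j x y) hne
    exact ⟨hWlegal j x a ha, hWlegal j y b hb⟩
  obtain ⟨Q, hQ'⟩ : ∃ Q : ℕ → Matrix (X × X) (X × X) ℝ, ∀ j xy xy', Q j xy xy' = ∑ a, ∑ b, q j xy.1 xy.2 a b * (μ0 (hub xy'.1)
      * (if comp xy'.1 + Pi.single a 1 = comp xy.1 + Pi.single (hub xy'.1) 1 then (1 : ℝ) else 0))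
      * ((if hub xy'.2 = hub xy'.1 then (1 : ℝ) else 0) * (if comp xy'.2 + Pi.single b 1 = comp xy.2 + Pi.single (hub xy'.2) 1 then (1 : ℝ) else 0)) :=
    ⟨_, fun _ _ _ => rfl⟩
  have hQ : ∀ j x y x' y', Q j (x, y) (x', y') = ∑ a, ∑ b, q j x y a b * (μ0 (hub x')
      * (if comp x' + Pi.single a 1 = comp x + Pi.single (hub x') 1 then (1 : ℝ) else 0))
      * ((if hub y' = hub x' then (1 : ℝ) else 0) * (if comp y' + Pi.single b 1 = comp y + Pi.single (hub y') 1 then (1 : ℝ) else 0)) :=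
    fun j x y x' y' => hQ' j (x, y) (x', y')
  have hMC : ∀ j, IsMarkovianCoupling (Cc j) (Q j) := fun j =>
    lumpedAny_isMarkovianCoupling (u := fun x => w j (comp x) (hub x)) hinj hsum hsurj hμ0 (hWlegal j) (hqc j) (hCj j) (hQ j)
  -- the insertion term and the one-step image of `Ψ`
  obtain ⟨Et, hEt⟩ : ∃ Et : X → X → ℝ, ∀ x y, Et x y = 2 * ∑ v, μ0 v * (-(1 - σ) * θ v) - (-(1 - σ) * θ (hub x)) - (-(1 - σ) * θ (hub y)) + 2 * ∑ v, μ0 v * θ v :=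
    ⟨_, fun _ _ => rfl⟩
  have hθbar0 : 0 ≤ ∑ v, μ0 v * θ v := sum_nonneg fun v _ => mul_nonneg (hμ0 v) (by linarith [(hθm v).1])
  have hθbar1 : ∑ v, μ0 v * θ v ≤ 1 := by
    calc ∑ v, μ0 v * θ v ≤ ∑ v, μ0 v := sum_le_sum fun v _ => mul_le_of_le_one_right (hμ0 v) (hθm v).2
      _ = 1 := hμ1
  have hEt' : ∀ x y, Et x y = 2 * σ * ∑ v, μ0 v * θ v + (1 - σ) * (θ (hub x) + θ (hub y)) := fun x y => by
    rw [hEt, show (∑ v, μ0 v * (-(1 - σ) * θ v)) = -(1 - σ) * ∑ v, μ0 v * θ v by rw [mul_sum]; exact sum_congr rfl fun v _ => by ring]; ring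
  have hEt0 : ∀ x y, 0 ≤ Et x y := fun x y => by
    rw [hEt']; nlinarith only [hθbar0, (hθm (hub x)).1, (hθm (hub y)).1, hσ0, hσ1]
  have hEt2 : ∀ x y, Et x y ≤ 2 := fun x y => by
    rw [hEt']; nlinarith only [hθbar1, (hθm (hub x)).2, (hθm (hub y)).2, hσ0, hσ1]
  have hEtsymm : ∀ x y, Et y x = Et x y := fun x y => by rw [hEt', hEt']; ring
  have hEteq : ∀ x y, hub x = hub y → Et x y = 2 * (1 - σ) * θ (hub x) + 2 * σ * ∑ v, μ0 v * θ v := fun x y hxy => by rw [hEt', hxy]; ring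
  have hmv : ∀ j x y, (Q j *ᵥ Ψ) (x, y) = ∑ a, ∑ b, q j x y a b * ((Δ (comp x - Pi.single a 1) (comp y - Pi.single b 1) : ℝ) * (F (x, y) + Et x y - θ a - θ b)) := by
    intro j x y; rw [hEt]
    exact lumpedAny_mulVec_potential (c := c) (C := C) (s := fun v => -(1 - σ) * θ v) (r := θ) hinj hsum hsurj hμ1 (hWlegal j) (hqc j) hΔ (hQ j) hF hΨ x y
  -- bounds on `F`, symmetry
  have hFc : ∀ x y, c ≤ F (x, y) := finiteOdds_F_ge hW hp0 hp hθ hσ0.le hhub hF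
  have hFmax : ∀ x y, F (x, y) ≤ c + 2 * K + 2 := finiteOdds_F_le hW hp0 hp hθ hσ1 hsum hF
  have hF1 : ∀ x y, 1 ≤ F (x, y) := fun x y => by linarith [hFc x y]
  have hFsymm : ∀ x y, F (y, x) = F (x, y) := fun x y => by
    rw [hF, hF, show (∑ v, θ v * ((comp y v : ℝ) + (comp x v : ℝ))) = ∑ v, θ v * ((comp x v : ℝ) + (comp y v : ℝ)) from sum_congr rfl fun v _ => by ring]; ring
  have hΔsymm : ∀ x y, Δ (comp y) (comp x) = Δ (comp x) (comp y) := fun x y => cdist_symm_of_sum_eq hΔ (by rw [hsum, hsum])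
  have hC1 : 1 ≤ C := by rw [hC]; nlinarith
  -- the value: signs, crude bounds, symmetry
  have hV0 : ∀ j x y, 0 ≤ (Q j *ᵥ Ψ) (x, y) := fun j x y => by
    rw [hmv]; exact perAttempt_value_nonneg (hqc j x y).1 (fun v => (hθm v).2) (by linarith [hFc x y, hEt0 x y])
  have hVB : ∀ j x y, (Q j *ᵥ Ψ) (x, y) ≤ (K + 1) * (c + 2 * K + 6) := fun j x y => by
    rw [hmv, hEt]
    exact finiteOdds_functional_le (u := fun x => w j (comp x) (hub x)) (q := q j) hW hp0 hp hθ (by linarith) hσ0.le hσ1 hμ0 hμ1 hΔ hsum (hqc j)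
      (fun x => (hWlaw j x).2) hF x y
  have hVadj : ∀ j x y, Δ (comp x) (comp y) = 1 → (Q j *ᵥ Ψ) (x, y) ≤ 2 * F (x, y) + 4 := fun j x y h1 => by
    rw [hmv]
    have h11 : ∑ a, ∑ b, q j x y a b = 1 := by
      rw [show (∑ a, ∑ b, q j x y a b) = ∑ a, w j (comp x) (hub x) a from sum_congr rfl fun a _ => (hqc j x y).2.1 a, (hWlaw j x).2]
    exact perAttempt_value_le_adjacent hΔ h1 (hqc j x y).1 h11 (hqleg j x y) (fun v => by linarith [(hθm v).1]) (by linarith [hFc x y]) (hEt2 x y)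
  have hVsymm : ∀ j x y, (Q j *ᵥ Ψ) (y, x) = (Q j *ᵥ Ψ) (x, y) := fun j x y => by
    rw [hmv, hmv, hFsymm, hEtsymm]
    have hqsymm : ∀ a b, q j y x a b = q j x y b a := fun a b => by rw [hq, hq, optimalCoupling_transpose]
    rw [show (∑ a, ∑ b, q j y x a b * ((Δ (comp y - Pi.single a 1) (comp x - Pi.single b 1) : ℝ) * (F (x, y) + Et x y - θ a - θ b)))
        = ∑ a, ∑ b, q j x y b a * ((Δ (comp y - Pi.single a 1) (comp x - Pi.single b 1) : ℝ) * (F (x, y) + Et x y - θ a - θ b)) from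
      sum_congr rfl fun a _ => sum_congr rfl fun b _ => by rw [hqsymm]]
    exact perAttempt_value_transpose hΔ (hsum x) (hsum y) (hqleg j x y) (fun a b => F (x, y) + Et x y - θ a - θ b) (fun a b => by ring)
  -- §2 edges, lengths, the path pseudo-metric (W19)
  let E : X → X → Prop := fun x y => (hub x = hub y ∧ Δ (comp x) (comp y) = 1) ∨ hub x ≠ hub y
  let ℓ : X → X → ℝ := fun x y => if hub x = hub y then F (x, y) else C
  have hℓ1 : ∀ a b, E a b → 1 ≤ ℓ a b := by
    intro a b _; simp only [ℓ]; split_ifs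
    · exact hF1 a b
    · exact hC1
  have hℓ0 : ∀ a b, E a b → 0 ≤ ℓ a b := fun a b h => zero_le_one.trans (hℓ1 a b h)
  have hℓpos : ∀ a b, 0 < ℓ a b := fun a b => by simp only [ℓ]; split_ifs; exacts [lt_of_lt_of_le one_pos (hF1 a b), lt_of_lt_of_le one_pos hC1]
  have hℓsymm : ∀ a b, ℓ b a = ℓ a b := fun a b => by
    simp only [ℓ]
    by_cases h : hub a = hub b
    · rw [if_pos h, if_pos h.symm, hFsymm]
    · rw [if_neg h, if_neg (fun h' => h h'.symm)]
  have hFeq : ∀ x y, hub x = hub y → (fun x y => F (x, y)) x y = (fun z => c + 2 * (-(1 - σ) * θ z)) (hub x) + ∑ v, θ v * ((comp x v : ℝ) + (comp y v : ℝ)) := by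
    intro x y hxy; simp only [hF x y, hxy]; ring
  have hpathEq := adjacent_path_le (F := fun x y => F (x, y)) (cz := fun z => c + 2 * (-(1 - σ) * θ z)) (θ := θ) hinj hsum hsurj hhub hΔ hFeq
  have hpath : ∀ x y, ∃ L, IsGraphPath E ℓ x y L ∧ L ≤ Ψ (x, y) := by
    intro x y
    by_cases hxy : hub x = hub y
    · obtain ⟨L, hL, hLle⟩ := hpathEq x y hxy
      refine ⟨L, graphPath_mono (fun a b hab => ⟨Or.inl hab, by simp only [ℓ, if_pos hab.1]⟩) hL, ?_⟩
      rw [hΨ, if_pos hxy, mul_zero, add_zero]; exact hLle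
    · refine ⟨ℓ x y + 0, IsGraphPath.cons (Or.inr hxy) (IsGraphPath.nil y), ?_⟩
      rw [hΨ, if_neg hxy]; simp only [ℓ, if_neg hxy]
      have : (0 : ℝ) ≤ (Δ (comp x) (comp y) : ℝ) * F (x, y) := mul_nonneg (Nat.cast_nonneg _) (zero_le_one.trans (hF1 x y))
      linarith
  obtain ⟨d, hle, happrox⟩ := exists_wpath (E := E) (ℓ := ℓ) hℓ0 (fun x y => by obtain ⟨L, hL, -⟩ := hpath x y; exact ⟨L, hL⟩)
  have hdΨ : ∀ x y, d x y ≤ Ψ (x, y) := fun x y => by obtain ⟨L, hL, hLle⟩ := hpath x y; exact (hle x y L hL).trans hLle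
  have hΨle : ∀ x y, Ψ (x, y) ≤ (K + 1) * (c + 2 * K + 2) + C := by
    intro x y
    rw [hΨ]
    have hΔle : (Δ (comp x) (comp y) : ℝ) ≤ K + 1 := by
      have := cdist_le_sum hΔ (comp x) (comp y); rw [hsum] at this; exact_mod_cast this
    have h1 : (Δ (comp x) (comp y) : ℝ) * F (x, y) ≤ (K + 1) * (c + 2 * K + 2) :=
      mul_le_mul hΔle (hFmax x y) (zero_le_one.trans (hF1 x y)) (by linarith)
    have h2 : C * (if hub x = hub y then (0 : ℝ) else 1) ≤ C := by split_ifs <;> nlinarith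
    linarith
  have hdD : ∀ x y, d x y ≤ (K + 1) * (c + 2 * K + 2) + C := fun x y => (hdΨ x y).trans (hΨle x y)
  -- §3 the per-edge per-attempt data
  obtain ⟨re, hre⟩ : ∃ re : ℕ → X → X → ℝ, ∀ j x y, re j x y = 1 - (Q j *ᵥ Ψ) (x, y) / ℓ x y := ⟨_, fun _ _ _ => rfl⟩
  have hresymm : ∀ j x y, re j y x = re j x y := fun j x y => by rw [hre, hre, hVsymm, hℓsymm]
  have hedge : ∀ j a b, E a b → ∃ θc, IsCoupling (Cc j a) (Cc j b) θc ∧ transportCost d θc ≤ (1 - re j a b) * ℓ a b := by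
    intro j x y _
    refine ⟨fun x' y' => Q j (x, y) (x', y'), hMC j x y, ?_⟩
    have hcost : transportCost d (fun x' y' => Q j (x, y) (x', y')) ≤ (Q j *ᵥ Ψ) (x, y) := by
      unfold transportCost
      rw [Matrix.mulVec, dotProduct, Fintype.sum_prod_type]
      exact sum_le_sum fun x' _ => sum_le_sum fun y' _ => by
        rw [mul_comm]; exact mul_le_mul_of_nonneg_left (hdΨ x' y') ((hMC j x y).1 x' y')
    have e : (1 - re j x y) * ℓ x y = (Q j *ᵥ Ψ) (x, y) := by rw [hre]; field_simp [(hℓpos x y).ne']; ring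
    rw [e]; exact hcost
  have hr1 : ∀ j a b, E a b → re j a b ≤ 1 := fun j a b _ => by
    rw [hre]; have := div_nonneg (hV0 j a b) (hℓpos a b).le; linarith
  have hrq : ∀ j a b, E a b → -(2 : ℝ) ≤ re j a b := by
    intro j x y hxy
    rw [hre]
    have key : (Q j *ᵥ Ψ) (x, y) ≤ 3 * ℓ x y := by
      rcases hxy with ⟨hh, h1⟩ | hh
      · simp only [ℓ, if_pos hh]; linarith [hVadj j x y h1, hFc x y]
      · simp only [ℓ, if_neg hh]; rw [hC]; nlinarith [hVB j x y, hK0, hFc x y, hF1 x y]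
    have := div_le_div_of_nonneg_right key (hℓpos x y).le
    rw [mul_div_assoc, div_self (hℓpos x y).ne', mul_one] at this
    linarith
  -- the mean condition on an ORIENTED adjacent equal-hub edge (file 2)
  have hmeanO : ∀ x y, hub x = hub y → Δ (comp x) (comp y) = 1 → W (bf x y) ≤ W (af x y) →
      ∀ n, ∑ j ∈ range n, σ ^ j * (1 - σ) * (1 - re j x y) ≤ 1 - rt := by
    intro x y hxy h1 hor n
    have ecx := hcx x y hxy h1 hor
    have ecy := hcy x y hxy h1 hor
    have hab : af x y ≠ bf x y := by
      intro e
      have : comp x = comp y := by rw [ecx, ecy, e]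
      have h0 : Δ (comp x) (comp y) = 0 := by rw [this]; exact cdist_self hΔ _
      omega
    have hNC : ∑ v, NCf x y v = K := by
      have h := hsum x; rw [ecx] at h; simp only [Pi.add_apply] at h; rw [sum_add_distrib, Finset.sum_pi_single'] at h; simp at h; omega
    have hz : NCf x y (hub x) ≠ 0 := by
      by_cases hza : hub x = af x y
      · have h := hhub y; rw [ecy, ← hxy] at h; simp only [Pi.add_apply, Pi.single_apply] at h
        rw [if_neg (fun e => hab (hza.symm.trans e))] at h; simpa using h
      · have h := hhub x; rw [ecx] at h; simp only [Pi.add_apply, Pi.single_apply, if_neg hza, add_zero] at h; exact h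
    -- the tagged `j`-attempt laws from the hub
    let xl : ℕ → Option S → ℝ := fun n => Nat.rec (motive := fun _ => Option S → ℝ) (fun t => if t = some (hub x) then 1 else 0)
      (fun _ prev t => ∑ h, prev h * PXf x y h t) n
    let yl : ℕ → Option S → ℝ := fun n => Nat.rec (motive := fun _ => Option S → ℝ) (fun t => if t = some (hub x) then 1 else 0)
      (fun _ prev t => ∑ h, prev h * PYf x y h t) n
    have hxl0 : ∀ t, xl 0 t = if t = some (hub x) then 1 else 0 := fun _ => rfl
    have hxls : ∀ n t, xl (n + 1) t = ∑ h, xl n h * PXf x y h t := fun _ _ => rfl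
    have hyl0 : ∀ t, yl 0 t = if t = some (hub x) then 1 else 0 := fun _ => rfl
    have hyls : ∀ n t, yl (n + 1) t = ∑ h, yl n h * PYf x y h t := fun _ _ => rfl
    -- the content `j`-attempt laws from the hub, forward recursion (file 1)
    have hwX0 : ∀ v, w 0 (comp x) (hub x) v = if v = hub x then 1 else 0 := fun v => hw0 (comp x) (hub x) v
    have hwXs : ∀ n v, w (n + 1) (comp x) (hub x) v = ∑ h, w n (comp x) (hub x) h * Kh (comp x) h v :=
      fun n v => hubLaw_forward hw0 hws n (comp x) (hub x) v
    have hwY0 : ∀ v, w 0 (comp y) (hub y) v = if v = hub x then 1 else 0 := fun v => by rw [← hxy]; exact hw0 (comp y) (hub x) v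
    have hwYs : ∀ n v, w (n + 1) (comp y) (hub y) v = ∑ h, w n (comp y) (hub y) h * Kh (comp y) h v :=
      fun n v => hubLaw_forward hw0 hws n (comp y) (hub y) v
    have key := adjacent_perAttempt_meanCondition (μ0 := μ0) (c := c) (wX := fun j => w j (comp x) (hub x)) (wY := fun j => w j (comp y) (hub y)) hΔ hW hp0 hp hθ hacc hK hNC hab hor ecx ecy hz
      (hPXoff x y hxy h1 hor) (hPXin x y hxy h1 hor) (hPXdiag x y hxy h1 hor) (hPXout x y hxy h1 hor) (hPXstay x y hxy h1 hor)
      (hPYoff x y hxy h1 hor) (hPYin x y hxy h1 hor) (hPYdiag x y hxy h1 hor) (hPYout x y hxy h1 hor) (hPYstay x y hxy h1 hor)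
      (fun h v hhv => hKoff (comp x) h v hhv) (hKdiag (comp x)) (fun h v hhv => hKoff (comp y) h v hhv) (hKdiag (comp y)) hσ0.le hσ1
      hxl0 hxls hyl0 hyls (hxtf x y hxy h1 hor) (hytf x y hxy h1 hor) (hxsf x y hxy h1 hor) (hysf x y hxy h1 hor)
      hwX0 hwXs hwY0 hwYs (Φ := F (x, y)) (by rw [hF, hxy]) hc hμ0 hμ1 hrt0.le hrtc n
    refine le_trans (le_of_eq (sum_congr rfl fun j _ => ?_)) key
    congr 1
    rw [hre, hmv, hEteq x y hxy]
    simp only [ℓ, if_pos hxy, hq, sub_sub_cancel]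
  have hmean : ∀ n a b, E a b → ∑ j ∈ range n, σ ^ j * (1 - σ) * (1 - re j a b) ≤ 1 - rt := by
    intro n x y hxy
    rcases hxy with ⟨hh, h1⟩ | hh
    · rcases horient x y hh h1 with hor | hor
      · exact hmeanO x y hh h1 hor n
      · have h1' : Δ (comp y) (comp x) = 1 := by rw [hΔsymm]; exact h1
        rw [show (∑ j ∈ range n, σ ^ j * (1 - σ) * (1 - re j x y)) = ∑ j ∈ range n, σ ^ j * (1 - σ) * (1 - re j y x) from
          sum_congr rfl fun j _ => by rw [hresymm]]
        exact hmeanO y x hh.symm h1' hor n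
    · -- unequal hubs: every term is at most half its weight
      have hw : ∀ j, 0 ≤ σ ^ j * (1 - σ) := fun j => mul_nonneg (pow_nonneg hσ0.le j) (by linarith)
      have hterm : ∀ j, 1 - re j x y ≤ 1 / 2 := fun j => by
        rw [hre]; simp only [ℓ, if_neg hh, sub_sub_cancel]
        rw [div_le_iff₀ (lt_of_lt_of_le one_pos hC1), hC]
        linarith [hVB j x y]
      calc ∑ j ∈ range n, σ ^ j * (1 - σ) * (1 - re j x y) ≤ ∑ j ∈ range n, σ ^ j * (1 - σ) * (1 / 2) :=
            sum_le_sum fun j _ => mul_le_mul_of_nonneg_left (hterm j) (hw j)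
        _ = (1 - σ ^ n) * (1 / 2) := by rw [← sum_mul, renewal_weights_sum]
        _ ≤ 1 - rt := by nlinarith only [pow_nonneg hσ0.le n, hrthalf]
  -- §4 chapter AC file 6
  have hrt2 : rt / 2 = σ * (p * ∑ v, μ0 v * (W v * θ v)) / (c + 2 * K + 2) := by rw [hrt]; ring
  have h := clock_worstTvDist_le_edgeRates (E := E) (ℓ := ℓ) (q := 2) hA0 hA1 hB0 hB1 hσ0.le hσ1 hS hSn0 hSns hAn0 hAns hC0 hCs hℓ1 hle happrox hdD hrt0 hrt1
    (by norm_num) hedge hrq hr1 hmean (fun x => (hπ x).le) hπ1 hstat (ε := (1 - σ) * (σ * (p * ∑ v, μ0 v * (W v * θ v)) / (c + 2 * K + 2)) / 48)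
    (by rw [hrt2]; norm_num) n
  rw [hrt2] at h
  exact h

end ClockLaw

end Summit.Ventures.LatticeQCDFlow.Scaling
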